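import Summits.ResolutionOfSingularities.ResolutionOfSingularities.Theorems.FrobeniusLadderFInjectiveMacaulayficationKawasakiDimLeTwo
import Summits.ResolutionOfSingularities.ResolutionOfSingularities.Theorems.FrobeniusLadderFInjectiveMacaulayficationFiClauseOfRegular
import Summits.ResolutionOfSingularities.ResolutionOfSingularities.Theorems.FInjectiveMacaulayfication.Negative.LoadBearing
import Literature.AlgebraicGeometry.Resolution.NormalSurfaceSingularLocus
import Mathlib.AlgebraicGeometry.Noetherian
import HarnessLib

/-!
# Generic F-injectivization holds in dimension `≤ 2`: the normalization is regular at every non-closed point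

Support file for crux stmt-ResolutionOfSingularities-15315 (`FrobeniusLadder.FInjectiveMacaulayfication`,
line `Sketch`): stub `stub_genericFInjectivizationDimLeTwo` of the isolation split. The research-level stub
`stub_genericFInjectivization` asks for a proper birational integral Cohen–Macaulay model every NON-CLOSED
point of which satisfies the crux's per-stalk clause (systems of parameters weakly regular and generating
Frobenius closed ideals). In dimension `≤ 2` this HOLDS — the codimension climb of line `isolation` is empty
below dimension `3` — with the model `X₂ → X₁` of `KawasakiDimLeTwo.normalModel_dim_le_two` (the
normalization: proper birational, integral of dimension `≤ 2`, all stalks integrally closed, Noetherian and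
Cohen–Macaulay):

* a non-closed point `x` of the normal surface `X₂` is a REGULAR point: singular points of a normal surface
  are closed (`Literature.AlgebraicGeometry.Resolution.isClosed_singleton_of_not_mem_regularLocus`: a proper
  specialization `x ⤳ y` gives `dim 𝒪_{X₂,x} < dim 𝒪_{X₂,y} ≤ 2`, and a normal Noetherian local domain of
  dimension `≤ 1` is a field or a discrete valuation ring, hence regular — Matsumura Thm. 11.2);
* the stalk has characteristic `p` (`Negative.charP_stalk`), and regular local rings of characteristic `p`
  satisfy the clause (`FiClauseOfRegular.stub_fiClauseOfRegular`: Matsumura Thm. 17.4 and Kunz 1969).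

References: H. Matsumura, *Commutative Ring Theory* (1987), Thm. 11.2, Thm. 14.3, Thm. 17.4; E. Kunz,
Amer. J. Math. 91 (1969). [folklore]
-/

-- single-problem summit: the doubled namespace component is forced
set_option linter.dupNamespace false

noncomputable section

namespace Summit.ResolutionOfSingularities.ResolutionOfSingularities.Theorems.FInjectiveMacaulayfication.GenericFInjectivizationDimLeTwo

open AlgebraicGeometry CategoryTheory Literature.AlgebraicGeometry.Resolution

/-- **GENERIC F-INJECTIVIZATION IN DIMENSION ≤ 2** (registered stub `stub_genericFInjectivizationDimLeTwo`):
for a prime `p`, a field `k` of characteristic `p` and an integral separated finite-type `X₁/k` of dimension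
`≤ 2` (with Cohen–Macaulay stalks — unused), the normal Cohen–Macaulay model `X₂ → X₁` of
`KawasakiDimLeTwo.normalModel_dim_le_two` is proper birational, integral, Cohen–Macaulay, and at every
NON-CLOSED point `x` of `X₂` every parameter ideal of `𝒪_{X₂,x}` is Frobenius closed: `X₂` is locally
Noetherian (locally of finite type over `k`), so the non-closed point `x` of the normal surface `X₂` is regular
(`isClosed_singleton_of_not_mem_regularLocus`), its stalk has characteristic `p` (`Negative.charP_stalk`), and
regular local rings of characteristic `p` satisfy the clause (`FiClauseOfRegular.stub_fiClauseOfRegular`).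
[folklore] -/
theorem stub_genericFInjectivizationDimLeTwo : ∀ (p : ℕ), p.Prime → ∀ (k : Type) [Field k] [CharP k p] (X₁ : Scheme.{0})
    (f₁ : X₁ ⟶ Spec (.of k)), IsSeparated f₁ → LocallyOfFiniteType f₁ → QuasiCompact f₁ → IsIntegral X₁ →
    topologicalKrullDim X₁ ≤ 2 →
    (∀ x : X₁, ∀ d : ℕ, ringKrullDim (X₁.presheaf.stalk x) = d →
      ∀ s : Fin d → X₁.presheaf.stalk x, (Ideal.span (Set.range s)).radical.IsMaximal →
        RingTheory.Sequence.IsWeaklyRegular (X₁.presheaf.stalk x) (List.ofFn s)) →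
    ∃ (X₂ : Scheme.{0}) (π : X₂ ⟶ X₁), IsProper π ∧ Literature.AlgebraicGeometry.Resolution.IsBirational π ∧
      IsIntegral X₂ ∧
      (∀ x : X₂, ∀ d : ℕ, ringKrullDim (X₂.presheaf.stalk x) = d →
        ∀ s : Fin d → X₂.presheaf.stalk x, (Ideal.span (Set.range s)).radical.IsMaximal →
          RingTheory.Sequence.IsWeaklyRegular (X₂.presheaf.stalk x) (List.ofFn s)) ∧
      ∀ x : X₂, ¬ IsClosed ({x} : Set X₂) → ∀ d : ℕ, ringKrullDim (X₂.presheaf.stalk x) = d →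
        ∀ s : Fin d → X₂.presheaf.stalk x, (Ideal.span (Set.range s)).radical.IsMaximal →
          ∀ y : X₂.presheaf.stalk x, (∃ e : ℕ, y ^ p ^ e ∈
            Ideal.span ((fun z : X₂.presheaf.stalk x => z ^ p ^ e) ''
              (Ideal.span (Set.range s) : Set (X₂.presheaf.stalk x)))) → y ∈ Ideal.span (Set.range s) := by
  intro p hp k _ _ X₁ f₁ hsep hft hqc hint hdim _
  haveI := hsep
  haveI := hft
  haveI := hqc
  haveI := hint
  obtain ⟨X₂, π, hprop, hbir, hint₂, hdim₂, hnorm, hCM⟩ :=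
    KawasakiDimLeTwo.normalModel_dim_le_two k X₁ f₁ hdim
  refine ⟨X₂, π, hprop, hbir, hint₂, hCM, fun x hx => ?_⟩
  haveI := hprop
  haveI := hint₂
  haveI : Fact p.Prime := ⟨hp⟩
  -- `X₂` is locally of finite type over `k`, hence locally Noetherian
  haveI : IsLocallyNoetherian X₂ := LocallyOfFiniteType.isLocallyNoetherian (π ≫ f₁)
  -- singular points of the normal surface `X₂` are closed, so the non-closed point `x` is regular
  haveI : IsRegularLocalRing (X₂.presheaf.stalk x) := by
    by_contra hreg
    exact hx (isClosed_singleton_of_not_mem_regularLocus hnorm hdim₂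
      (fun hmem => hreg ((Scheme.mem_regularLocus x).mp hmem)))
  haveI : CharP (X₂.presheaf.stalk x) p := Negative.charP_stalk hp.ne_zero (π ≫ f₁) x
  exact fun d hd s hs =>
    ((FiClauseOfRegular.stub_fiClauseOfRegular p (X₂.presheaf.stalk x)).2 d hd s hs).2

end Summit.ResolutionOfSingularities.ResolutionOfSingularities.Theorems.FInjectiveMacaulayfication.GenericFInjectivizationDimLeTwo

end
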